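import Summits.ValiantsHypothesis.ValiantsHypothesis.Theorems.GrenetZeonDualUnipotentThreeHalvesLongMassCommutingSum
import Summits.ValiantsHypothesis.ValiantsHypothesis.Theorems.GrenetZeonDualUnipotentThreeHalvesLongMassAcyclic

/-!
# `GrenetZeon.DualUnipotentThreeHalves` (stmt-ValiantsHypothesis-24318), line `slow_core`, stub (c) `SlowCore.LongMassSlowLawInv`:
# KRONECKER SUMS OF CHEAP SPACES ARE CHEAP (submodule currency)

Sequel of ✓ `…LongMassCommutingSum` (`price_sup_of_commute`: the intrinsic (c)-price is sub-additive over COMMUTING sums).  Here the headline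
example is made a theorem.  For `V₁ ≤ M_{b₁}(ℂ)`, `V₂ ≤ M_{b₂}(ℂ)` and any re-indexing `e : Fin b₁ × Fin b₂ ≃ Fin b`:

* ★ `price_kroneckerLeft_submodule` — the embedding `A ↦ e·(A ⊗ 1)·e⁻¹` keeps every certificate and its price
  (`(A ⊗ 1 + s·(w ⊗ 1))^p = (A + s w)^p ⊗ 1`; dimensions preserved for `b₂ ≥ 1`);
* ★ `price_kroneckerRight_submodule` — likewise `B ↦ e·(1 ⊗ B)·e⁻¹`;
* `kroneckerLeft_comm_kroneckerRight` — the two images commute (`(A ⊗ 1)(1 ⊗ B) = A ⊗ B = (1 ⊗ B)(A ⊗ 1)`);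
* ★★★ `price_kroneckerSum_submodule` — the KRONECKER SUM `e·(V₁ ⊗ 1 + 1 ⊗ V₂)·e⁻¹ ≤ M_b(ℂ)` has price `≤ price(V₁) + price(V₂)` at every
  window `n`.

Kronecker sums `L ⊗ 1 + 1 ⊗ L'` are the standard construction of IRREDUCIBLE nilpotent matrix spaces of growing nil-index (irreducible when
both factors are, by Burnside; index `idx L + idx L' − 1`); they are NOT block-triangular, so ✓ `relCert_of_levelCut` does not price them.  By
this file they never enter the live box of (c) unless a FACTOR is already expensive (crit-7 V34 §2/§3: a further dead template, now by name).

All statements are def-free: the embeddings enter as linear maps `κ` with `hκ : ∀ A, κ A = Matrix.reindex e e (A ⊗ₖ 1)` (resp. `1 ⊗ₖ B`).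
Honest framing.  A composition rule (`--supports stmt-ValiantsHypothesis-24318`), NOT progress on (c): (c) `SlowCore.LongMassSlowLawInv`, S3,
the crux 24318, 8062 and `VP ≠ VNP` remain OPEN / NOT proved.  No sorry, no definitions, no named facts.
-/

-- single-conjunct layout: Sub = Summit, duplicated namespace component intended (the name is mandated)
set_option linter.dupNamespace false
set_option autoImplicit false

noncomputable section

namespace Summit.ValiantsHypothesis.ValiantsHypothesis.Theorems.GrenetZeon.LongMassHomogenise

open MvPolynomial Matrix
open scoped BigOperators Kronecker
open Summit.ValiantsHypothesis.ValiantsHypothesis.Theorems.GrenetZeon.TriangularRow (submatrix_equiv_pow)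

variable {b b₁ b₂ : ℕ}

/-! ## §1 Kronecker powers and the line matrix -/

/-- `(M ⊗ 1)^p = M^p ⊗ 1`. -/
theorem kroneckerLeft_pow {R : Type*} [CommRing R] (M : Matrix (Fin b₁) (Fin b₁) R) (p : ℕ) :
    (M ⊗ₖ (1 : Matrix (Fin b₂) (Fin b₂) R)) ^ p = (M ^ p) ⊗ₖ (1 : Matrix (Fin b₂) (Fin b₂) R) := by
  induction p with
  | zero => rw [pow_zero, pow_zero, one_kronecker_one]
  | succ p ih => rw [pow_succ, pow_succ, ih, ← mul_kronecker_mul, Matrix.mul_one]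

/-- `(1 ⊗ M)^p = 1 ⊗ M^p`. -/
theorem kroneckerRight_pow {R : Type*} [CommRing R] (M : Matrix (Fin b₂) (Fin b₂) R) (p : ℕ) :
    ((1 : Matrix (Fin b₁) (Fin b₁) R) ⊗ₖ M) ^ p = (1 : Matrix (Fin b₁) (Fin b₁) R) ⊗ₖ (M ^ p) := by
  induction p with
  | zero => rw [pow_zero, pow_zero, one_kronecker_one]
  | succ p ih => rw [pow_succ, pow_succ, ih, ← mul_kronecker_mul, Matrix.mul_one]

/-- The line matrix of the left Kronecker embedding is the embedded line matrix. -/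
theorem lineMat_kroneckerLeft (e : Fin b₁ × Fin b₂ ≃ Fin b) (A w : Matrix (Fin b₁) (Fin b₁) ℂ) :
    ((Matrix.reindex e e (A ⊗ₖ (1 : Matrix (Fin b₂) (Fin b₂) ℂ))).map (C : ℂ → MvPolynomial (Fin 1) ℂ) +
        (X 0 : MvPolynomial (Fin 1) ℂ) • (Matrix.reindex e e (w ⊗ₖ (1 : Matrix (Fin b₂) (Fin b₂) ℂ))).map C) =
      Matrix.reindex e e ((A.map (C : ℂ → MvPolynomial (Fin 1) ℂ) + (X 0 : MvPolynomial (Fin 1) ℂ) • w.map C) ⊗ₖ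
        (1 : Matrix (Fin b₂) (Fin b₂) (MvPolynomial (Fin 1) ℂ))) := by
  ext i j : 2
  simp only [Matrix.reindex_apply, Matrix.submatrix_apply, Matrix.map_apply, Matrix.add_apply, Matrix.smul_apply,
    Matrix.kroneckerMap_apply, Matrix.one_apply, smul_eq_mul]
  split_ifs <;> simp

/-- The line matrix of the right Kronecker embedding is the embedded line matrix. -/
theorem lineMat_kroneckerRight (e : Fin b₁ × Fin b₂ ≃ Fin b) (A w : Matrix (Fin b₂) (Fin b₂) ℂ) :
    ((Matrix.reindex e e ((1 : Matrix (Fin b₁) (Fin b₁) ℂ) ⊗ₖ A)).map (C : ℂ → MvPolynomial (Fin 1) ℂ) +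
        (X 0 : MvPolynomial (Fin 1) ℂ) • (Matrix.reindex e e ((1 : Matrix (Fin b₁) (Fin b₁) ℂ) ⊗ₖ w)).map C) =
      Matrix.reindex e e ((1 : Matrix (Fin b₁) (Fin b₁) (MvPolynomial (Fin 1) ℂ)) ⊗ₖ
        (A.map (C : ℂ → MvPolynomial (Fin 1) ℂ) + (X 0 : MvPolynomial (Fin 1) ℂ) • w.map C)) := by
  ext i j : 2
  simp only [Matrix.reindex_apply, Matrix.submatrix_apply, Matrix.map_apply, Matrix.add_apply, Matrix.smul_apply,
    Matrix.kroneckerMap_apply, Matrix.one_apply, smul_eq_mul]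
  split_ifs <;> simp

/-! ## §2 The embeddings keep certificates -/

/-- ★ **THE LEFT KRONECKER EMBEDDING `A ↦ e·(A ⊗ 1)·e⁻¹` KEEPS CERTIFICATES** (submodule currency, `b₂ ≥ 1`). -/
theorem price_kroneckerLeft_submodule (e : Fin b₁ × Fin b₂ ≃ Fin b) (hb₂ : 0 < b₂)
    (κ : Matrix (Fin b₁) (Fin b₁) ℂ →ₗ[ℂ] Matrix (Fin b) (Fin b) ℂ)
    (hκ : ∀ A, κ A = Matrix.reindex e e (A ⊗ₖ (1 : Matrix (Fin b₂) (Fin b₂) ℂ)))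
    (V : Submodule ℂ (Matrix (Fin b₁) (Fin b₁) ℂ)) {n P : ℕ}
    (h : ∃ (W : Submodule ℂ (Matrix (Fin b₁) (Fin b₁) ℂ)) (k : ℕ), W ≤ V ∧
      (∀ A ∈ V, ∀ w ∈ W, ∀ p : ℕ, p ≤ n - 1 → ∀ i j : Fin b₁,
        ((((A.map (C : ℂ → MvPolynomial (Fin 1) ℂ) + (X 0 : MvPolynomial (Fin 1) ℂ) • w.map C) ^ p :
          Matrix (Fin b₁) (Fin b₁) (MvPolynomial (Fin 1) ℂ)) i j).totalDegree ≤ k)) ∧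
      n * k + (Module.finrank ℂ V - Module.finrank ℂ W) ≤ P) :
    ∃ (W : Submodule ℂ (Matrix (Fin b) (Fin b) ℂ)) (k : ℕ), W ≤ V.map κ ∧
      (∀ A ∈ V.map κ, ∀ w ∈ W, ∀ p : ℕ, p ≤ n - 1 → ∀ i j : Fin b,
        ((((A.map (C : ℂ → MvPolynomial (Fin 1) ℂ) + (X 0 : MvPolynomial (Fin 1) ℂ) • w.map C) ^ p :
          Matrix (Fin b) (Fin b) (MvPolynomial (Fin 1) ℂ)) i j).totalDegree ≤ k)) ∧
      n * k + (Module.finrank ℂ ↥(V.map κ) - Module.finrank ℂ W) ≤ P := by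
  obtain ⟨W, k, hW, hwin, hprice⟩ := h
  have hκinj : Function.Injective κ := by
    intro A B hAB
    rw [hκ, hκ] at hAB
    have h' := (Matrix.reindex e e).injective hAB
    ext i j
    have := congr_fun (congr_fun h' (i, ⟨0, hb₂⟩)) (j, ⟨0, hb₂⟩)
    simpa [Matrix.kroneckerMap_apply] using this
  have hdim : ∀ U : Submodule ℂ (Matrix (Fin b₁) (Fin b₁) ℂ), Module.finrank ℂ ↥(U.map κ) = Module.finrank ℂ U :=
    fun U => (LinearEquiv.finrank_eq (Submodule.equivMapOfInjective κ hκinj U)).symm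
  refine ⟨W.map κ, k, Submodule.map_mono hW, ?_, by rw [hdim, hdim]; exact hprice⟩
  intro A' hA' w' hw' p hp i j
  obtain ⟨A, hA, rfl⟩ := Submodule.mem_map.mp hA'
  obtain ⟨w, hw, rfl⟩ := Submodule.mem_map.mp hw'
  rw [hκ, hκ, lineMat_kroneckerLeft]
  set M := A.map (C : ℂ → MvPolynomial (Fin 1) ℂ) + (X 0 : MvPolynomial (Fin 1) ℂ) • w.map C with hM
  rw [Matrix.reindex_apply, submatrix_equiv_pow, kroneckerLeft_pow, Matrix.submatrix_apply, Matrix.kroneckerMap_apply,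
    Matrix.one_apply]
  refine (totalDegree_mul _ _).trans ?_
  have h1 : (if (e.symm i).2 = (e.symm j).2 then (1 : MvPolynomial (Fin 1) ℂ) else 0).totalDegree = 0 := by
    split_ifs
    · exact totalDegree_one
    · exact totalDegree_zero
  rw [h1, add_zero]
  exact hwin A hA w hw p hp _ _

/-- ★ **THE RIGHT KRONECKER EMBEDDING `B ↦ e·(1 ⊗ B)·e⁻¹` KEEPS CERTIFICATES** (submodule currency, `b₁ ≥ 1`). -/
theorem price_kroneckerRight_submodule (e : Fin b₁ × Fin b₂ ≃ Fin b) (hb₁ : 0 < b₁)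
    (κ : Matrix (Fin b₂) (Fin b₂) ℂ →ₗ[ℂ] Matrix (Fin b) (Fin b) ℂ)
    (hκ : ∀ B, κ B = Matrix.reindex e e ((1 : Matrix (Fin b₁) (Fin b₁) ℂ) ⊗ₖ B))
    (V : Submodule ℂ (Matrix (Fin b₂) (Fin b₂) ℂ)) {n P : ℕ}
    (h : ∃ (W : Submodule ℂ (Matrix (Fin b₂) (Fin b₂) ℂ)) (k : ℕ), W ≤ V ∧
      (∀ A ∈ V, ∀ w ∈ W, ∀ p : ℕ, p ≤ n - 1 → ∀ i j : Fin b₂,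
        ((((A.map (C : ℂ → MvPolynomial (Fin 1) ℂ) + (X 0 : MvPolynomial (Fin 1) ℂ) • w.map C) ^ p :
          Matrix (Fin b₂) (Fin b₂) (MvPolynomial (Fin 1) ℂ)) i j).totalDegree ≤ k)) ∧
      n * k + (Module.finrank ℂ V - Module.finrank ℂ W) ≤ P) :
    ∃ (W : Submodule ℂ (Matrix (Fin b) (Fin b) ℂ)) (k : ℕ), W ≤ V.map κ ∧
      (∀ A ∈ V.map κ, ∀ w ∈ W, ∀ p : ℕ, p ≤ n - 1 → ∀ i j : Fin b,
        ((((A.map (C : ℂ → MvPolynomial (Fin 1) ℂ) + (X 0 : MvPolynomial (Fin 1) ℂ) • w.map C) ^ p :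
          Matrix (Fin b) (Fin b) (MvPolynomial (Fin 1) ℂ)) i j).totalDegree ≤ k)) ∧
      n * k + (Module.finrank ℂ ↥(V.map κ) - Module.finrank ℂ W) ≤ P := by
  obtain ⟨W, k, hW, hwin, hprice⟩ := h
  have hκinj : Function.Injective κ := by
    intro A B hAB
    rw [hκ, hκ] at hAB
    have h' := (Matrix.reindex e e).injective hAB
    ext i j
    have := congr_fun (congr_fun h' (⟨0, hb₁⟩, i)) (⟨0, hb₁⟩, j)
    simpa [Matrix.kroneckerMap_apply] using this
  have hdim : ∀ U : Submodule ℂ (Matrix (Fin b₂) (Fin b₂) ℂ), Module.finrank ℂ ↥(U.map κ) = Module.finrank ℂ U :=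
    fun U => (LinearEquiv.finrank_eq (Submodule.equivMapOfInjective κ hκinj U)).symm
  refine ⟨W.map κ, k, Submodule.map_mono hW, ?_, by rw [hdim, hdim]; exact hprice⟩
  intro A' hA' w' hw' p hp i j
  obtain ⟨A, hA, rfl⟩ := Submodule.mem_map.mp hA'
  obtain ⟨w, hw, rfl⟩ := Submodule.mem_map.mp hw'
  rw [hκ, hκ, lineMat_kroneckerRight]
  set M := A.map (C : ℂ → MvPolynomial (Fin 1) ℂ) + (X 0 : MvPolynomial (Fin 1) ℂ) • w.map C with hM
  rw [Matrix.reindex_apply, submatrix_equiv_pow, kroneckerRight_pow, Matrix.submatrix_apply, Matrix.kroneckerMap_apply,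
    Matrix.one_apply]
  refine (totalDegree_mul _ _).trans ?_
  have h1 : (if (e.symm i).1 = (e.symm j).1 then (1 : MvPolynomial (Fin 1) ℂ) else 0).totalDegree = 0 := by
    split_ifs
    · exact totalDegree_one
    · exact totalDegree_zero
  rw [h1, zero_add]
  exact hwin A hA w hw p hp _ _

/-! ## §3 Kronecker sums -/

/-- The two Kronecker embeddings commute: `(A ⊗ 1)(1 ⊗ B) = A ⊗ B = (1 ⊗ B)(A ⊗ 1)`. -/
theorem kroneckerLeft_comm_kroneckerRight (e : Fin b₁ × Fin b₂ ≃ Fin b) (A : Matrix (Fin b₁) (Fin b₁) ℂ)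
    (B : Matrix (Fin b₂) (Fin b₂) ℂ) :
    Matrix.reindex e e (A ⊗ₖ (1 : Matrix (Fin b₂) (Fin b₂) ℂ)) * Matrix.reindex e e ((1 : Matrix (Fin b₁) (Fin b₁) ℂ) ⊗ₖ B) =
      Matrix.reindex e e ((1 : Matrix (Fin b₁) (Fin b₁) ℂ) ⊗ₖ B) * Matrix.reindex e e (A ⊗ₖ (1 : Matrix (Fin b₂) (Fin b₂) ℂ)) := by
  simp only [Matrix.reindex_apply, Matrix.submatrix_mul_equiv, ← mul_kronecker_mul, Matrix.mul_one, Matrix.one_mul]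

/-- ★★★ **KRONECKER SUMS OF CHEAP SPACES ARE CHEAP**: the Kronecker sum `e·(V₁ ⊗ 1 + 1 ⊗ V₂)·e⁻¹ ≤ M_b(ℂ)` of `V₁ ≤ M_{b₁}(ℂ)` and
`V₂ ≤ M_{b₂}(ℂ)` (`b₁, b₂ ≥ 1`, `e : Fin b₁ × Fin b₂ ≃ Fin b`) has, at every window `n`, a certificate of price `≤ P₁ + P₂` whenever the factors
have certificates of prices `≤ P₁`, `≤ P₂`. -/
theorem price_kroneckerSum_submodule (e : Fin b₁ × Fin b₂ ≃ Fin b) (hb₁ : 0 < b₁) (hb₂ : 0 < b₂)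
    (κ₁ : Matrix (Fin b₁) (Fin b₁) ℂ →ₗ[ℂ] Matrix (Fin b) (Fin b) ℂ)
    (hκ₁ : ∀ A, κ₁ A = Matrix.reindex e e (A ⊗ₖ (1 : Matrix (Fin b₂) (Fin b₂) ℂ)))
    (κ₂ : Matrix (Fin b₂) (Fin b₂) ℂ →ₗ[ℂ] Matrix (Fin b) (Fin b) ℂ)
    (hκ₂ : ∀ B, κ₂ B = Matrix.reindex e e ((1 : Matrix (Fin b₁) (Fin b₁) ℂ) ⊗ₖ B))
    (V₁ : Submodule ℂ (Matrix (Fin b₁) (Fin b₁) ℂ)) (V₂ : Submodule ℂ (Matrix (Fin b₂) (Fin b₂) ℂ)) {n P₁ P₂ : ℕ}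
    (h₁ : ∃ (W : Submodule ℂ (Matrix (Fin b₁) (Fin b₁) ℂ)) (k : ℕ), W ≤ V₁ ∧
      (∀ A ∈ V₁, ∀ w ∈ W, ∀ p : ℕ, p ≤ n - 1 → ∀ i j : Fin b₁,
        ((((A.map (C : ℂ → MvPolynomial (Fin 1) ℂ) + (X 0 : MvPolynomial (Fin 1) ℂ) • w.map C) ^ p :
          Matrix (Fin b₁) (Fin b₁) (MvPolynomial (Fin 1) ℂ)) i j).totalDegree ≤ k)) ∧
      n * k + (Module.finrank ℂ V₁ - Module.finrank ℂ W) ≤ P₁)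
    (h₂ : ∃ (W : Submodule ℂ (Matrix (Fin b₂) (Fin b₂) ℂ)) (k : ℕ), W ≤ V₂ ∧
      (∀ A ∈ V₂, ∀ w ∈ W, ∀ p : ℕ, p ≤ n - 1 → ∀ i j : Fin b₂,
        ((((A.map (C : ℂ → MvPolynomial (Fin 1) ℂ) + (X 0 : MvPolynomial (Fin 1) ℂ) • w.map C) ^ p :
          Matrix (Fin b₂) (Fin b₂) (MvPolynomial (Fin 1) ℂ)) i j).totalDegree ≤ k)) ∧
      n * k + (Module.finrank ℂ V₂ - Module.finrank ℂ W) ≤ P₂) :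
    ∃ (W : Submodule ℂ (Matrix (Fin b) (Fin b) ℂ)) (k : ℕ), W ≤ V₁.map κ₁ ⊔ V₂.map κ₂ ∧
      (∀ A ∈ V₁.map κ₁ ⊔ V₂.map κ₂, ∀ w ∈ W, ∀ p : ℕ, p ≤ n - 1 → ∀ i j : Fin b,
        ((((A.map (C : ℂ → MvPolynomial (Fin 1) ℂ) + (X 0 : MvPolynomial (Fin 1) ℂ) • w.map C) ^ p :
          Matrix (Fin b) (Fin b) (MvPolynomial (Fin 1) ℂ)) i j).totalDegree ≤ k)) ∧
      n * k + (Module.finrank ℂ ↥(V₁.map κ₁ ⊔ V₂.map κ₂) - Module.finrank ℂ W) ≤ P₁ + P₂ := by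
  have hcomm : ∀ A₁ ∈ V₁.map κ₁, ∀ A₂ ∈ V₂.map κ₂, A₁ * A₂ = A₂ * A₁ := by
    intro A₁ hA₁ A₂ hA₂
    obtain ⟨A, -, rfl⟩ := Submodule.mem_map.mp hA₁
    obtain ⟨B, -, rfl⟩ := Submodule.mem_map.mp hA₂
    rw [hκ₁, hκ₂]
    exact kroneckerLeft_comm_kroneckerRight e A B
  exact price_sup_of_commute (V₁.map κ₁) (V₂.map κ₂) hcomm
    (price_kroneckerLeft_submodule e hb₂ κ₁ hκ₁ V₁ h₁) (price_kroneckerRight_submodule e hb₁ κ₂ hκ₂ V₂ h₂)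

end Summit.ValiantsHypothesis.ValiantsHypothesis.Theorems.GrenetZeon.LongMassHomogenise

end
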